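import Summits.Ventures.GridStability.Bench.SMIBDeg6AK13postD10Data1
import Summits.Ventures.GridStability.Bench.SMIBDeg6AK13postD10BallB1
import Summits.Ventures.GridStability.Bench.SMIBDeg6AK13postD10BallB2
import Summits.Ventures.GridStability.Bench.SMIBDeg6AK13postD10BallB3
import Summits.Ventures.GridStability.Bench.SMIBDeg6AK13postD10BallB4
import Summits.Ventures.GridStability.Lyapunov.PolyRecastBernsteinCoeffs
import Summits.Ventures.GridStability.Lyapunov.RecastShellBounds
import Mathlib.Tactic.Linarith
import Mathlib.Tactic.Positivity
import Mathlib.Tactic.IntervalCases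
import HarnessLib

/-!
# G1.SMIB+ «SMIB deg-6» (K13 post-fault, D = 1/10) — REGION-SIZE rider «SMIB-DEG6 BALL-B» (lever L2: BERNSTEIN enclosure on the manifold-aware SIGNED shell cover, K = 8;
# supersession `_B`) (recast half): the ball `σ² + κ² + ω²/36 ≤ (3/5)²` on `{h = 0}` lies in the certified sublevel piece `{V₆ ≤ 17/7}`

Venture GRIDFUSION, cell `gridfusion`; seat gridfusion-lyap-2 (g6; declared INSTRUMENT line «T1-KERNEL · BERN», lead g8 RULING 9bo (1); SUPERSESSION
«BALL-B» of the rider «SMIB-DEG6 BALL-M» — record `Bench/SMIBDeg6AK13postD10BallM.lean` p562789 (s = 287/500, coefficient majorant `absBox` on the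
manifold-aware shell cover) — under NEW names: this file `Bench/SMIBDeg6AK13postD10BallB.lean` + box files `…BallB1…4.lean`, every declaration
suffixed `_B`; the earlier files are untouched), LOW rider. WHAT CHANGED: the per-box test is no longer the coefficient majorant
`Σ|c_m|ΠB_i^(e_i) ≤ c` (`PolyRecast.absBox`, blind to sign cancellation between monomials) but the TENSOR-BERNSTEIN RANGE ENCLOSURE
`max_J b_J(V; box) ≤ c` (Cargo–Shisha / Garloff: on the box, `V` is a convex combination of its Bernstein coefficients), with the
coefficients COMPUTED BY THE KERNEL from the literal `deg6_A_K13postD10_V_poly` and the box corners and RE-VERIFIED as a representation of `V`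
(`Lyapunov/PolyRecastBernstein.lean` p565768: `bernUpper` ⊇ `bernRep`; `Lyapunov/PolyRecastBernsteinCoeffs.lean`: `bernCoeffs`,
`eval_le_of_bernCoeffs`) — still ONE `decide` per box on literals only; and the boxes are the TRUE shell boxes: σ SIGNED
(`σ ∈ [τ_k, τ_(k+1)]` or `[−τ_(k+1), −τ_k]`) and `κ ∈ [κlo_k, κhi_k]` (the majorant could only use `|σ| ≤ τ_(k+1)`, `|κ| ≤ κhi_k`).
Inputs: the literal `deg6_A_K13postD10_V_poly` (81 monomials, degree 6) and the recast constraint `deg6_A_K13postD10_h` of `Bench/SMIBDeg6AK13postD10Data1.lean`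
(sos-3 A certificate `SMIBDeg6AK13postD10{Data1,Data2,Part1,Part2,}.lean`; -roa `Bench/SMIBDeg6AK13postD10Roa.lean` (lyap-2 g4 p549968) on lyap-1's deg-4 bridge; model half `…RoaModel.lean` p551976); the circle lemmas `Lyapunov/RecastShellBounds.lean` (lyap-2 g5 p560544). NOTHING of the certificate is restated; generator
`gen_bernball.py D 8 emit` (HOME/lean/lyap-2/g6/; `s` = the largest multiple of 1/1000 whose 16 boxes pass, found in float and
CONFIRMED in exact rational arithmetic by a Python mirror of `bernCoeffs`; at `s + 1/1000` the worst box fails).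

WHAT IS PROVED (kernel). With `s = 3/5`: on `{h = 0}` (`h = κ² + σ² − 2κ`) the ellipsoid `σ² + κ² + ω²/36 ≤ s²` is COVERED by 8 shells
`τ_k² < σ² ≤ τ_(k+1)²` up to `σ_max² = s² − s⁴/4 = 819/2500` (`τ_8 = 573/1000`, `τ_8² ≥ σ_max²`; lever L1 (a)), each the union of
TWO boxes (sign of σ) with `κlo_k ≤ κ ≤ κhi_k` (`κhi_k ≥ 1 − √(1 − τ_(k+1)²)`, `κlo_k ≤ 1 − √(1 − τ_k²)`, rational, from `(1 − κ)² = 1 − σ²`;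
L1 (b)) and `|ω| ≤ Ω_k`, `Ω_k² ≥ W²(s² − 2κlo_k)`, `W = 6` (L1 (c)); on EACH of the 16 boxes the kernel-computed Bernstein coefficients
of `V` are `≤ 17/7` (box files, one `decide` per box; worst exact maximum ≈ 2.423473); hence `V ≤ 17/7 = c` on the
ellipsoid — IT LIES IN THE CERTIFIED PIECE (`deg6_A_K13postD10_V_le_level_of_ball_B`). Reach for this row (gauge radius `s`): BALL-M
287/500 (32.9°) → BALL-B 3/5 (34.4°); record ONE-box and BALL+ values in LEVER-NOTE §1 (angle = the model
reading `s·180/π` at `ω = 0`, VALIDATED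
rendering of the exact literal; the float TRUE inscribed radius of the gauge ellipsoid in the piece is larger still, LEVER-NOTE §1).

THREE COLUMNS. CERTIFIED (kernel): the inclusion «ellipsoid of gauge radius `3/5` ∩ {h = 0} ⊆ {V ≤ 17/7}» for the certificate's `V` —
a box-cover Bernstein-enclosure inner estimate, exact; an inner set of a CERTIFICATE's sublevel piece, never «the ROA of the system».
MODELLED: as the parent row (M′ = the classical SMIB swing equation (model-1 `SMIB`, instance K13postD10: [Kundur1994, Ex. 13] post-fault network, uniform damping D = 1/10); MODEL-VALIDITY MV-1/MV-2 (classical machine, constant voltage behind transient reactance, no governor/AVR, lossless reduced network)). VALIDATED: only the renderings of `s`. No sentence here says a machine, a converter or a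
grid is stable.
-/

namespace Summit.Ventures.GridStability.Bench.SMIB

open Literature.Computation.Certificates Literature.Computation.Certificates.SOS
open Literature.Computation.Certificates.SOS.Poly
open Summit.Ventures.GridStability.Lyapunov

noncomputable section

/-- From a passed Bernstein box test to the bound on `V`: if the kernel-computed tensor-Bernstein coefficients of `deg6_A_K13postD10_V_poly` on
`[l0, u0] × [l1, u1] × [l2, u2]` are `≤ 17/7` (`PolyRecast.bernUpper … (bernCoeffs …)`, re-verified representation) and `(σ, κ, ω)` lies in
the box, then `V σ κ ω ≤ 17/7` (`PolyRecast.eval_le_of_bernCoeffs`). [folklore] -/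
theorem deg6_A_K13postD10_V_le_of_bern_B (sigma kappa omega : ℝ) (l0 l1 l2 u0 u1 u2 : ℚ)
    (hdec : PolyRecast.bernUpper deg6_A_K13postD10_V_poly [6, 6, 6] (vars [l0, l1, l2]) (vars [u0, u1, u2])
      (PolyRecast.bernCoeffs deg6_A_K13postD10_V_poly [6, 6, 6] (vars [l0, l1, l2]) (vars [u0, u1, u2])) ((17 : ℚ)/7) = true)
    (hb0 : ((l0 : ℚ) : ℝ) ≤ sigma ∧ sigma ≤ ((u0 : ℚ) : ℝ)) (hb1 : ((l1 : ℚ) : ℝ) ≤ kappa ∧ kappa ≤ ((u1 : ℚ) : ℝ))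
    (hb2 : ((l2 : ℚ) : ℝ) ≤ omega ∧ omega ≤ ((u2 : ℚ) : ℝ)) :
    deg6_A_K13postD10_V sigma kappa omega ≤ (17 / 7 : ℝ) := by
  have hx : ∀ i, i < ([6, 6, 6] : List ℕ).length → ((vars [l0, l1, l2] i : ℚ) : ℝ) ≤ vars [sigma, kappa, omega] i ∧
      vars [sigma, kappa, omega] i ≤ ((vars [u0, u1, u2] i : ℚ) : ℝ) := by
    intro i hi
    have hi3 : i < 3 := by simpa using hi
    interval_cases i
    · simpa using hb0
    · simpa using hb1
    · simpa using hb2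
  have h := PolyRecast.eval_le_of_bernCoeffs (K := ℝ) hdec hx
  have hc : ((((17 : ℚ)/7) : ℚ) : ℝ) = (17 / 7 : ℝ) := by norm_num
  exact h.trans_eq hc

/-- Shell 0 of the cover (`(0)² < σ² ≤ (203/1000)²`): literal bounds `κ ∈ [0, 10411/500000]`, `|ω| ≤ 18/5` from `h = 0` and the
gauge, then the two signed boxes 0+ / 0− (box theorems `deg6_A_K13postD10_bern_le0p_B` / `deg6_A_K13postD10_bern_le0m_B`). [folklore] -/
theorem deg6_A_K13postD10_V_le_shell0_B (sigma kappa omega : ℝ) (hh' : sigma ^ 2 + kappa ^ 2 = 2 * kappa)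
    (hball : sigma ^ 2 + kappa ^ 2 + omega ^ 2 / 36 ≤ (3 / 5 : ℝ) ^ 2) (hk1one : kappa ≤ 1) (hk1lo : 0 ≤ kappa)
    (hsq : sigma ^ 2 ≤ (203 / 1000 : ℝ) ^ 2) : deg6_A_K13postD10_V sigma kappa omega ≤ (17 / 7 : ℝ) := by
  have hw2 : 0 ≤ omega ^ 2 / 36 := by positivity
  have hkhi : kappa ≤ (10411 / 500000 : ℝ) := RecastShell.kappa_le_of_sq_le hh' hk1one hsq (by norm_num)
  have hklo : (0 : ℝ) ≤ kappa := by simpa using hk1lo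
  have hom : -(18 / 5 : ℝ) ≤ omega ∧ omega ≤ (18 / 5 : ℝ) :=
    abs_le_of_sq_le_sq' (by linarith [hh', hball, hk1lo, (by norm_num : ((6 : ℝ)) ^ 2 * ((9 / 25 : ℝ) - 2 * (0 : ℝ)) ≤ (18 / 5 : ℝ) ^ 2)]) (by norm_num)
  have habs : -(203 / 1000 : ℝ) ≤ sigma ∧ sigma ≤ (203 / 1000 : ℝ) := abs_le_of_sq_le_sq' hsq (by norm_num)
  rcases le_total 0 sigma with hsg | hsg
  · exact deg6_A_K13postD10_V_le_of_bern_B sigma kappa omega _ _ _ _ _ _ deg6_A_K13postD10_bern_le0p_B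
      (by push_cast; constructor <;> linarith [hsg, habs.2]) (by push_cast; constructor <;> linarith [hklo, hkhi])
      (by push_cast; constructor <;> linarith [hom.1, hom.2])
  · exact deg6_A_K13postD10_V_le_of_bern_B sigma kappa omega _ _ _ _ _ _ deg6_A_K13postD10_bern_le0m_B
      (by push_cast; constructor <;> linarith [hsg, habs.1]) (by push_cast; constructor <;> linarith [hklo, hkhi])
      (by push_cast; constructor <;> linarith [hom.1, hom.2])

/-- Shell 1 of the cover (`(203/1000)² < σ² ≤ (287/1000)²`): literal bounds `κ ∈ [20821/1000000, 4207/100000]`, `|ω| ≤ 1693/500` from `h = 0` and the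
gauge, then the two signed boxes 1+ / 1− (box theorems `deg6_A_K13postD10_bern_le1p_B` / `deg6_A_K13postD10_bern_le1m_B`). [folklore] -/
theorem deg6_A_K13postD10_V_le_shell1_B (sigma kappa omega : ℝ) (hh' : sigma ^ 2 + kappa ^ 2 = 2 * kappa)
    (hball : sigma ^ 2 + kappa ^ 2 + omega ^ 2 / 36 ≤ (3 / 5 : ℝ) ^ 2) (hk1one : kappa ≤ 1)
    (hlo : (203 / 1000 : ℝ) ^ 2 < sigma ^ 2) 
    (hsq : sigma ^ 2 ≤ (287 / 1000 : ℝ) ^ 2) : deg6_A_K13postD10_V sigma kappa omega ≤ (17 / 7 : ℝ) := by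
  have hw2 : 0 ≤ omega ^ 2 / 36 := by positivity
  have hkhi : kappa ≤ (4207 / 100000 : ℝ) := RecastShell.kappa_le_of_sq_le hh' hk1one hsq (by norm_num)
  have hklo' : (20821 / 1000000 : ℝ) < kappa := RecastShell.lt_kappa_of_lt_sq hh' hk1one hlo (by norm_num) (by norm_num)
  have hklo : (20821 / 1000000 : ℝ) ≤ kappa := hklo'.le
  have hom : -(1693 / 500 : ℝ) ≤ omega ∧ omega ≤ (1693 / 500 : ℝ) :=
    abs_le_of_sq_le_sq' (by linarith [hh', hball, hklo', (by norm_num : ((6 : ℝ)) ^ 2 * ((9 / 25 : ℝ) - 2 * (20821 / 1000000 : ℝ)) ≤ (1693 / 500 : ℝ) ^ 2)]) (by norm_num)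
  have habs : -(287 / 1000 : ℝ) ≤ sigma ∧ sigma ≤ (287 / 1000 : ℝ) := abs_le_of_sq_le_sq' hsq (by norm_num)
  rcases le_total 0 sigma with hsg | hsg
  · have hslo : (203 / 1000 : ℝ) < sigma := lt_of_pow_lt_pow_left₀ 2 hsg hlo
    exact deg6_A_K13postD10_V_le_of_bern_B sigma kappa omega _ _ _ _ _ _ deg6_A_K13postD10_bern_le1p_B
      (by push_cast; constructor <;> linarith [hslo, habs.2]) (by push_cast; constructor <;> linarith [hklo, hkhi])
      (by push_cast; constructor <;> linarith [hom.1, hom.2])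
  · have hshi : (203 / 1000 : ℝ) < -sigma := lt_of_pow_lt_pow_left₀ 2 (by linarith) (by rw [neg_sq]; exact hlo)
    exact deg6_A_K13postD10_V_le_of_bern_B sigma kappa omega _ _ _ _ _ _ deg6_A_K13postD10_bern_le1m_B
      (by push_cast; constructor <;> linarith [hshi, habs.1]) (by push_cast; constructor <;> linarith [hklo, hkhi])
      (by push_cast; constructor <;> linarith [hom.1, hom.2])

/-- Shell 2 of the cover (`(287/1000)² < σ² ≤ (351/1000)²`): literal bounds `κ ∈ [42069/1000000, 509/8000]`, `|ω| ≤ 394/125` from `h = 0` and the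
gauge, then the two signed boxes 2+ / 2− (box theorems `deg6_A_K13postD10_bern_le2p_B` / `deg6_A_K13postD10_bern_le2m_B`). [folklore] -/
theorem deg6_A_K13postD10_V_le_shell2_B (sigma kappa omega : ℝ) (hh' : sigma ^ 2 + kappa ^ 2 = 2 * kappa)
    (hball : sigma ^ 2 + kappa ^ 2 + omega ^ 2 / 36 ≤ (3 / 5 : ℝ) ^ 2) (hk1one : kappa ≤ 1)
    (hlo : (287 / 1000 : ℝ) ^ 2 < sigma ^ 2) 
    (hsq : sigma ^ 2 ≤ (351 / 1000 : ℝ) ^ 2) : deg6_A_K13postD10_V sigma kappa omega ≤ (17 / 7 : ℝ) := by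
  have hw2 : 0 ≤ omega ^ 2 / 36 := by positivity
  have hkhi : kappa ≤ (509 / 8000 : ℝ) := RecastShell.kappa_le_of_sq_le hh' hk1one hsq (by norm_num)
  have hklo' : (42069 / 1000000 : ℝ) < kappa := RecastShell.lt_kappa_of_lt_sq hh' hk1one hlo (by norm_num) (by norm_num)
  have hklo : (42069 / 1000000 : ℝ) ≤ kappa := hklo'.le
  have hom : -(394 / 125 : ℝ) ≤ omega ∧ omega ≤ (394 / 125 : ℝ) :=
    abs_le_of_sq_le_sq' (by linarith [hh', hball, hklo', (by norm_num : ((6 : ℝ)) ^ 2 * ((9 / 25 : ℝ) - 2 * (42069 / 1000000 : ℝ)) ≤ (394 / 125 : ℝ) ^ 2)]) (by norm_num)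
  have habs : -(351 / 1000 : ℝ) ≤ sigma ∧ sigma ≤ (351 / 1000 : ℝ) := abs_le_of_sq_le_sq' hsq (by norm_num)
  rcases le_total 0 sigma with hsg | hsg
  · have hslo : (287 / 1000 : ℝ) < sigma := lt_of_pow_lt_pow_left₀ 2 hsg hlo
    exact deg6_A_K13postD10_V_le_of_bern_B sigma kappa omega _ _ _ _ _ _ deg6_A_K13postD10_bern_le2p_B
      (by push_cast; constructor <;> linarith [hslo, habs.2]) (by push_cast; constructor <;> linarith [hklo, hkhi])
      (by push_cast; constructor <;> linarith [hom.1, hom.2])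
  · have hshi : (287 / 1000 : ℝ) < -sigma := lt_of_pow_lt_pow_left₀ 2 (by linarith) (by rw [neg_sq]; exact hlo)
    exact deg6_A_K13postD10_V_le_of_bern_B sigma kappa omega _ _ _ _ _ _ deg6_A_K13postD10_bern_le2m_B
      (by push_cast; constructor <;> linarith [hshi, habs.1]) (by push_cast; constructor <;> linarith [hklo, hkhi])
      (by push_cast; constructor <;> linarith [hom.1, hom.2])

/-- Shell 3 of the cover (`(351/1000)² < σ² ≤ (203/500)²`): literal bounds `κ ∈ [7953/125000, 86127/1000000]`, `|ω| ≤ 579/200` from `h = 0` and the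
gauge, then the two signed boxes 3+ / 3− (box theorems `deg6_A_K13postD10_bern_le3p_B` / `deg6_A_K13postD10_bern_le3m_B`). [folklore] -/
theorem deg6_A_K13postD10_V_le_shell3_B (sigma kappa omega : ℝ) (hh' : sigma ^ 2 + kappa ^ 2 = 2 * kappa)
    (hball : sigma ^ 2 + kappa ^ 2 + omega ^ 2 / 36 ≤ (3 / 5 : ℝ) ^ 2) (hk1one : kappa ≤ 1)
    (hlo : (351 / 1000 : ℝ) ^ 2 < sigma ^ 2) 
    (hsq : sigma ^ 2 ≤ (203 / 500 : ℝ) ^ 2) : deg6_A_K13postD10_V sigma kappa omega ≤ (17 / 7 : ℝ) := by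
  have hw2 : 0 ≤ omega ^ 2 / 36 := by positivity
  have hkhi : kappa ≤ (86127 / 1000000 : ℝ) := RecastShell.kappa_le_of_sq_le hh' hk1one hsq (by norm_num)
  have hklo' : (7953 / 125000 : ℝ) < kappa := RecastShell.lt_kappa_of_lt_sq hh' hk1one hlo (by norm_num) (by norm_num)
  have hklo : (7953 / 125000 : ℝ) ≤ kappa := hklo'.le
  have hom : -(579 / 200 : ℝ) ≤ omega ∧ omega ≤ (579 / 200 : ℝ) :=
    abs_le_of_sq_le_sq' (by linarith [hh', hball, hklo', (by norm_num : ((6 : ℝ)) ^ 2 * ((9 / 25 : ℝ) - 2 * (7953 / 125000 : ℝ)) ≤ (579 / 200 : ℝ) ^ 2)]) (by norm_num)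
  have habs : -(203 / 500 : ℝ) ≤ sigma ∧ sigma ≤ (203 / 500 : ℝ) := abs_le_of_sq_le_sq' hsq (by norm_num)
  rcases le_total 0 sigma with hsg | hsg
  · have hslo : (351 / 1000 : ℝ) < sigma := lt_of_pow_lt_pow_left₀ 2 hsg hlo
    exact deg6_A_K13postD10_V_le_of_bern_B sigma kappa omega _ _ _ _ _ _ deg6_A_K13postD10_bern_le3p_B
      (by push_cast; constructor <;> linarith [hslo, habs.2]) (by push_cast; constructor <;> linarith [hklo, hkhi])
      (by push_cast; constructor <;> linarith [hom.1, hom.2])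
  · have hshi : (351 / 1000 : ℝ) < -sigma := lt_of_pow_lt_pow_left₀ 2 (by linarith) (by rw [neg_sq]; exact hlo)
    exact deg6_A_K13postD10_V_le_of_bern_B sigma kappa omega _ _ _ _ _ _ deg6_A_K13postD10_bern_le3m_B
      (by push_cast; constructor <;> linarith [hshi, habs.1]) (by push_cast; constructor <;> linarith [hklo, hkhi])
      (by push_cast; constructor <;> linarith [hom.1, hom.2])

/-- Shell 4 of the cover (`(203/500)² < σ² ≤ (453/1000)²`): literal bounds `κ ∈ [43063/500000, 10849/100000]`, `|ω| ≤ 13/5` from `h = 0` and the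
gauge, then the two signed boxes 4+ / 4− (box theorems `deg6_A_K13postD10_bern_le4p_B` / `deg6_A_K13postD10_bern_le4m_B`). [folklore] -/
theorem deg6_A_K13postD10_V_le_shell4_B (sigma kappa omega : ℝ) (hh' : sigma ^ 2 + kappa ^ 2 = 2 * kappa)
    (hball : sigma ^ 2 + kappa ^ 2 + omega ^ 2 / 36 ≤ (3 / 5 : ℝ) ^ 2) (hk1one : kappa ≤ 1)
    (hlo : (203 / 500 : ℝ) ^ 2 < sigma ^ 2) 
    (hsq : sigma ^ 2 ≤ (453 / 1000 : ℝ) ^ 2) : deg6_A_K13postD10_V sigma kappa omega ≤ (17 / 7 : ℝ) := by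
  have hw2 : 0 ≤ omega ^ 2 / 36 := by positivity
  have hkhi : kappa ≤ (10849 / 100000 : ℝ) := RecastShell.kappa_le_of_sq_le hh' hk1one hsq (by norm_num)
  have hklo' : (43063 / 500000 : ℝ) < kappa := RecastShell.lt_kappa_of_lt_sq hh' hk1one hlo (by norm_num) (by norm_num)
  have hklo : (43063 / 500000 : ℝ) ≤ kappa := hklo'.le
  have hom : -(13 / 5 : ℝ) ≤ omega ∧ omega ≤ (13 / 5 : ℝ) :=
    abs_le_of_sq_le_sq' (by linarith [hh', hball, hklo', (by norm_num : ((6 : ℝ)) ^ 2 * ((9 / 25 : ℝ) - 2 * (43063 / 500000 : ℝ)) ≤ (13 / 5 : ℝ) ^ 2)]) (by norm_num)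
  have habs : -(453 / 1000 : ℝ) ≤ sigma ∧ sigma ≤ (453 / 1000 : ℝ) := abs_le_of_sq_le_sq' hsq (by norm_num)
  rcases le_total 0 sigma with hsg | hsg
  · have hslo : (203 / 500 : ℝ) < sigma := lt_of_pow_lt_pow_left₀ 2 hsg hlo
    exact deg6_A_K13postD10_V_le_of_bern_B sigma kappa omega _ _ _ _ _ _ deg6_A_K13postD10_bern_le4p_B
      (by push_cast; constructor <;> linarith [hslo, habs.2]) (by push_cast; constructor <;> linarith [hklo, hkhi])
      (by push_cast; constructor <;> linarith [hom.1, hom.2])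
  · have hshi : (203 / 500 : ℝ) < -sigma := lt_of_pow_lt_pow_left₀ 2 (by linarith) (by rw [neg_sq]; exact hlo)
    exact deg6_A_K13postD10_V_le_of_bern_B sigma kappa omega _ _ _ _ _ _ deg6_A_K13postD10_bern_le4m_B
      (by push_cast; constructor <;> linarith [hshi, habs.1]) (by push_cast; constructor <;> linarith [hklo, hkhi])
      (by push_cast; constructor <;> linarith [hom.1, hom.2])

/-- Shell 5 of the cover (`(453/1000)² < σ² ≤ (497/1000)²`): literal bounds `κ ∈ [108489/1000000, 529/4000]`, `|ω| ≤ 227/100` from `h = 0` and the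
gauge, then the two signed boxes 5+ / 5− (box theorems `deg6_A_K13postD10_bern_le5p_B` / `deg6_A_K13postD10_bern_le5m_B`). [folklore] -/
theorem deg6_A_K13postD10_V_le_shell5_B (sigma kappa omega : ℝ) (hh' : sigma ^ 2 + kappa ^ 2 = 2 * kappa)
    (hball : sigma ^ 2 + kappa ^ 2 + omega ^ 2 / 36 ≤ (3 / 5 : ℝ) ^ 2) (hk1one : kappa ≤ 1)
    (hlo : (453 / 1000 : ℝ) ^ 2 < sigma ^ 2) 
    (hsq : sigma ^ 2 ≤ (497 / 1000 : ℝ) ^ 2) : deg6_A_K13postD10_V sigma kappa omega ≤ (17 / 7 : ℝ) := by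
  have hw2 : 0 ≤ omega ^ 2 / 36 := by positivity
  have hkhi : kappa ≤ (529 / 4000 : ℝ) := RecastShell.kappa_le_of_sq_le hh' hk1one hsq (by norm_num)
  have hklo' : (108489 / 1000000 : ℝ) < kappa := RecastShell.lt_kappa_of_lt_sq hh' hk1one hlo (by norm_num) (by norm_num)
  have hklo : (108489 / 1000000 : ℝ) ≤ kappa := hklo'.le
  have hom : -(227 / 100 : ℝ) ≤ omega ∧ omega ≤ (227 / 100 : ℝ) :=
    abs_le_of_sq_le_sq' (by linarith [hh', hball, hklo', (by norm_num : ((6 : ℝ)) ^ 2 * ((9 / 25 : ℝ) - 2 * (108489 / 1000000 : ℝ)) ≤ (227 / 100 : ℝ) ^ 2)]) (by norm_num)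
  have habs : -(497 / 1000 : ℝ) ≤ sigma ∧ sigma ≤ (497 / 1000 : ℝ) := abs_le_of_sq_le_sq' hsq (by norm_num)
  rcases le_total 0 sigma with hsg | hsg
  · have hslo : (453 / 1000 : ℝ) < sigma := lt_of_pow_lt_pow_left₀ 2 hsg hlo
    exact deg6_A_K13postD10_V_le_of_bern_B sigma kappa omega _ _ _ _ _ _ deg6_A_K13postD10_bern_le5p_B
      (by push_cast; constructor <;> linarith [hslo, habs.2]) (by push_cast; constructor <;> linarith [hklo, hkhi])
      (by push_cast; constructor <;> linarith [hom.1, hom.2])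
  · have hshi : (453 / 1000 : ℝ) < -sigma := lt_of_pow_lt_pow_left₀ 2 (by linarith) (by rw [neg_sq]; exact hlo)
    exact deg6_A_K13postD10_V_le_of_bern_B sigma kappa omega _ _ _ _ _ _ deg6_A_K13postD10_bern_le5m_B
      (by push_cast; constructor <;> linarith [hshi, habs.1]) (by push_cast; constructor <;> linarith [hklo, hkhi])
      (by push_cast; constructor <;> linarith [hom.1, hom.2])

/-- Shell 6 of the cover (`(497/1000)² < σ² ≤ (67/125)²`): literal bounds `κ ∈ [132249/1000000, 155783/1000000]`, `|ω| ≤ 371/200` from `h = 0` and the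
gauge, then the two signed boxes 6+ / 6− (box theorems `deg6_A_K13postD10_bern_le6p_B` / `deg6_A_K13postD10_bern_le6m_B`). [folklore] -/
theorem deg6_A_K13postD10_V_le_shell6_B (sigma kappa omega : ℝ) (hh' : sigma ^ 2 + kappa ^ 2 = 2 * kappa)
    (hball : sigma ^ 2 + kappa ^ 2 + omega ^ 2 / 36 ≤ (3 / 5 : ℝ) ^ 2) (hk1one : kappa ≤ 1)
    (hlo : (497 / 1000 : ℝ) ^ 2 < sigma ^ 2) 
    (hsq : sigma ^ 2 ≤ (67 / 125 : ℝ) ^ 2) : deg6_A_K13postD10_V sigma kappa omega ≤ (17 / 7 : ℝ) := by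
  have hw2 : 0 ≤ omega ^ 2 / 36 := by positivity
  have hkhi : kappa ≤ (155783 / 1000000 : ℝ) := RecastShell.kappa_le_of_sq_le hh' hk1one hsq (by norm_num)
  have hklo' : (132249 / 1000000 : ℝ) < kappa := RecastShell.lt_kappa_of_lt_sq hh' hk1one hlo (by norm_num) (by norm_num)
  have hklo : (132249 / 1000000 : ℝ) ≤ kappa := hklo'.le
  have hom : -(371 / 200 : ℝ) ≤ omega ∧ omega ≤ (371 / 200 : ℝ) :=
    abs_le_of_sq_le_sq' (by linarith [hh', hball, hklo', (by norm_num : ((6 : ℝ)) ^ 2 * ((9 / 25 : ℝ) - 2 * (132249 / 1000000 : ℝ)) ≤ (371 / 200 : ℝ) ^ 2)]) (by norm_num)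
  have habs : -(67 / 125 : ℝ) ≤ sigma ∧ sigma ≤ (67 / 125 : ℝ) := abs_le_of_sq_le_sq' hsq (by norm_num)
  rcases le_total 0 sigma with hsg | hsg
  · have hslo : (497 / 1000 : ℝ) < sigma := lt_of_pow_lt_pow_left₀ 2 hsg hlo
    exact deg6_A_K13postD10_V_le_of_bern_B sigma kappa omega _ _ _ _ _ _ deg6_A_K13postD10_bern_le6p_B
      (by push_cast; constructor <;> linarith [hslo, habs.2]) (by push_cast; constructor <;> linarith [hklo, hkhi])
      (by push_cast; constructor <;> linarith [hom.1, hom.2])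
  · have hshi : (497 / 1000 : ℝ) < -sigma := lt_of_pow_lt_pow_left₀ 2 (by linarith) (by rw [neg_sq]; exact hlo)
    exact deg6_A_K13postD10_V_le_of_bern_B sigma kappa omega _ _ _ _ _ _ deg6_A_K13postD10_bern_le6m_B
      (by push_cast; constructor <;> linarith [hshi, habs.1]) (by push_cast; constructor <;> linarith [hklo, hkhi])
      (by push_cast; constructor <;> linarith [hom.1, hom.2])

/-- Shell 7 of the cover (`(67/125)² < σ² ≤ (573/1000)²`): literal bounds `κ ∈ [77891/500000, 9/50]`, `|ω| ≤ 1321/1000` from `h = 0` and the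
gauge, then the two signed boxes 7+ / 7− (box theorems `deg6_A_K13postD10_bern_le7p_B` / `deg6_A_K13postD10_bern_le7m_B`). [folklore] -/
theorem deg6_A_K13postD10_V_le_shell7_B (sigma kappa omega : ℝ) (hh' : sigma ^ 2 + kappa ^ 2 = 2 * kappa)
    (hball : sigma ^ 2 + kappa ^ 2 + omega ^ 2 / 36 ≤ (3 / 5 : ℝ) ^ 2) (hk1one : kappa ≤ 1)
    (hlo : (67 / 125 : ℝ) ^ 2 < sigma ^ 2) 
    (hsq : sigma ^ 2 ≤ (573 / 1000 : ℝ) ^ 2) : deg6_A_K13postD10_V sigma kappa omega ≤ (17 / 7 : ℝ) := by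
  have hw2 : 0 ≤ omega ^ 2 / 36 := by positivity
  have hkhi : kappa ≤ (9 / 50 : ℝ) := by linarith [hh', hball, hw2]
  have hklo' : (77891 / 500000 : ℝ) < kappa := RecastShell.lt_kappa_of_lt_sq hh' hk1one hlo (by norm_num) (by norm_num)
  have hklo : (77891 / 500000 : ℝ) ≤ kappa := hklo'.le
  have hom : -(1321 / 1000 : ℝ) ≤ omega ∧ omega ≤ (1321 / 1000 : ℝ) :=
    abs_le_of_sq_le_sq' (by linarith [hh', hball, hklo', (by norm_num : ((6 : ℝ)) ^ 2 * ((9 / 25 : ℝ) - 2 * (77891 / 500000 : ℝ)) ≤ (1321 / 1000 : ℝ) ^ 2)]) (by norm_num)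
  have habs : -(573 / 1000 : ℝ) ≤ sigma ∧ sigma ≤ (573 / 1000 : ℝ) := abs_le_of_sq_le_sq' hsq (by norm_num)
  rcases le_total 0 sigma with hsg | hsg
  · have hslo : (67 / 125 : ℝ) < sigma := lt_of_pow_lt_pow_left₀ 2 hsg hlo
    exact deg6_A_K13postD10_V_le_of_bern_B sigma kappa omega _ _ _ _ _ _ deg6_A_K13postD10_bern_le7p_B
      (by push_cast; constructor <;> linarith [hslo, habs.2]) (by push_cast; constructor <;> linarith [hklo, hkhi])
      (by push_cast; constructor <;> linarith [hom.1, hom.2])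
  · have hshi : (67 / 125 : ℝ) < -sigma := lt_of_pow_lt_pow_left₀ 2 (by linarith) (by rw [neg_sq]; exact hlo)
    exact deg6_A_K13postD10_V_le_of_bern_B sigma kappa omega _ _ _ _ _ _ deg6_A_K13postD10_bern_le7m_B
      (by push_cast; constructor <;> linarith [hshi, habs.1]) (by push_cast; constructor <;> linarith [hklo, hkhi])
      (by push_cast; constructor <;> linarith [hom.1, hom.2])

/-- **«BALL» (recast coordinates, Bernstein enclosure on the manifold-aware signed shell cover, K = 8): the ellipsoid of gauge radius
`3/5` lies in the certified piece.** For every point of `{h = 0}` with `σ² + κ² + ω²/36 ≤ (3/5)²`: `V ≤ 17/7` (shell of `σ²` up to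
`σ_max² = s² − s⁴/4`, then the shell lemmas `…V_le_shell<k>_B`). [folklore] -/
theorem deg6_A_K13postD10_V_le_level_of_ball_B (sigma kappa omega : ℝ)
    (hh : deg6_A_K13postD10_h sigma kappa omega = 0)
    (hball : sigma ^ 2 + kappa ^ 2 + omega ^ 2 / 36 ≤ (3 / 5 : ℝ) ^ 2) :
    deg6_A_K13postD10_V sigma kappa omega ≤ (17 / 7 : ℝ) := by
  simp only [deg6_A_K13postD10_h, deg6_A_K13postD10_h_poly, eval_cons, eval_nil, Monomial.eval_eq, Monomial.evalFrom_cons, Monomial.evalFrom_nil,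
    vars_cons_zero, vars_cons_succ] at hh
  push_cast at hh
  norm_num at hh
  have hh' : sigma ^ 2 + kappa ^ 2 = 2 * kappa := by linarith [hh]
  have hk1lo : 0 ≤ kappa := RecastShell.kappa_nonneg hh'
  have hk1s : kappa ≤ (9 / 50 : ℝ) := by linarith [hh, hball, sq_nonneg sigma, sq_nonneg kappa, sq_nonneg omega]
  have hk1one : kappa ≤ 1 := by linarith [hk1s]
  have hsmax : sigma ^ 2 ≤ (573 / 1000 : ℝ) ^ 2 := by
    have hcut := RecastShell.sq_le_of_kappa_le (m := (9 / 50 : ℝ)) hh' hk1s (by norm_num)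
    have hnum : 2 * (9 / 50 : ℝ) - (9 / 50 : ℝ) ^ 2 ≤ ((573 / 1000 : ℝ)) ^ 2 := by norm_num
    linarith [hcut, hnum]
  rcases le_or_gt (sigma ^ 2) ((203 / 1000 : ℝ) ^ 2) with hs1 | hs1
  · exact deg6_A_K13postD10_V_le_shell0_B sigma kappa omega hh' hball hk1one hk1lo hs1
  rcases le_or_gt (sigma ^ 2) ((287 / 1000 : ℝ) ^ 2) with hs2 | hs2
  · exact deg6_A_K13postD10_V_le_shell1_B sigma kappa omega hh' hball hk1one hs1 hs2
  rcases le_or_gt (sigma ^ 2) ((351 / 1000 : ℝ) ^ 2) with hs3 | hs3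
  · exact deg6_A_K13postD10_V_le_shell2_B sigma kappa omega hh' hball hk1one hs2 hs3
  rcases le_or_gt (sigma ^ 2) ((203 / 500 : ℝ) ^ 2) with hs4 | hs4
  · exact deg6_A_K13postD10_V_le_shell3_B sigma kappa omega hh' hball hk1one hs3 hs4
  rcases le_or_gt (sigma ^ 2) ((453 / 1000 : ℝ) ^ 2) with hs5 | hs5
  · exact deg6_A_K13postD10_V_le_shell4_B sigma kappa omega hh' hball hk1one hs4 hs5
  rcases le_or_gt (sigma ^ 2) ((497 / 1000 : ℝ) ^ 2) with hs6 | hs6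
  · exact deg6_A_K13postD10_V_le_shell5_B sigma kappa omega hh' hball hk1one hs5 hs6
  rcases le_or_gt (sigma ^ 2) ((67 / 125 : ℝ) ^ 2) with hs7 | hs7
  · exact deg6_A_K13postD10_V_le_shell6_B sigma kappa omega hh' hball hk1one hs6 hs7
  exact deg6_A_K13postD10_V_le_shell7_B sigma kappa omega hh' hball hk1one hs7 hsmax

end

end Summit.Ventures.GridStability.Bench.SMIB
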